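import Summits.ResolutionOfSingularities.ResolutionOfSingularities.Theorems.EquisingularLiftEquisingularLiftNatSaturatedLift
import Summits.ResolutionOfSingularities.ResolutionOfSingularities.Theorems.EquisingularLiftEquisingularLiftNatRatLiftAlgebra
import Literature.AlgebraicGeometry.Motives.ProjBasicOpenSubscheme
import Literature.AlgebraicGeometry.Resolution.ProjectiveSpaceRegular
import Literature.AlgebraicGeometry.Resolution.AlterationsProofs
import HarnessLib

/-!
# [OURS · L1 W4.5(b) · EL♮(3)] T-RATREG — the cofinite clause of a parametrisation by forms makes the centre `V(𝓘_Z)` REGULAR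
# (the «ℙ^r ≅ Z» identification done chartwise: `(k[x]_{x_i})₀ / 𝔭_{(x_i)} ≅ (k[s]_{f_i})₀ = 𝒪(D₊(f_i) ⊂ ℙ^r_k)`)

Cell `res-hironaka`, LADDER-RESOLUTION rung L (D-0089), slot W4.5(b); crux **EL♮(3)** `EquisingularLiftNatThree`
(stmt-ResolutionOfSingularities-20148) / parent EL♮ (stmt-20038); res-L1-w45b-plan-1 PLANNER-MEMO-g10-1 object O1 «RatLift» (the successor
constructor `rat` of lead-2's liftable nose class, 2026-08-27T12:22:39Z). OURS; NOT a statement of any manuscript; AI-written, weaker than expert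
review. No definition, no `sorry`, standard axioms. `--supports stmt-ResolutionOfSingularities-20148 --as helper`; closes nothing by itself.

WHAT. `SatLift.liftableCentre_of_saturatedLift` (p530902) turns res-type-032's saturated lift of `𝔭 = ker (aeval f)` (T-RATLIFT-ALG parts 1–3)
into a liftable centre for `Z = V₊(𝔭)` PROVIDED the reduced `V(𝓘_Z)` is a regular scheme — the one downstairs input that is not a polynomial
identity. This file discharges it from the SAME downstairs data the ring core uses (shape (B) of res-type-032): forms `f : Fin (n+1) → k[s₀..s_r]`
of one degree `e ≥ 1` and the COFINITE CLAUSE `∀ m ≥ m₀, k[s]_{e m} ≤ aeval f (k[x]_m)` («`ℙ^r_k → ℙⁿ_k`, `s ↦ f(s)`, is a closed immersion»):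

* `exists_awayHom` — on the chart `D₊(x_i)` the substitution `x ↦ f` induces a ring homomorphism `Θ_i : (k[x]_{x_i})₀ → (k[s]_{f_i})₀`,
  `g / x_i^m ↦ (aeval f g) / f_i^m` (def-free: built inside the proof from Mathlib's `IsLocalization.map` and the injective `val`);
* `ker_awayHom_eq` — `ker Θ_i = 𝔭_{(x_i)}` (`SatLift.mk_mem_awayIdeal_iff`); `awayHom_surjective` — `Θ_i` is ONTO under the cofinite clause;
* `isRegular_Spec_away` — `Spec (k[s]_{f_i})₀ ≅ D₊(f_i) ⊆ ℙ^r_k` is regular (`isRegular_projectiveSpace`, `Scheme.IsRegular.of_isOpenImmersion`);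
* `isRegular_subscheme_projIdealSheaf_ker_aeval` — `V(𝔭~)` is REGULAR: it is covered by the pieces `Spec (Γ(D₊(x_i)) / 𝔭~(D₊(x_i)))`
  (`ProjSubscheme.subschemePiece`), and `Γ(D₊(x_i)) / 𝔭~(D₊(x_i)) ≅ (k[x]_{x_i})₀ / 𝔭_{(x_i)} ≅ (k[s]_{f_i})₀`;
* **`isRegular_subscheme_vanishingIdeal_of_clause`** — hence `V(𝓘_Z)` is regular for `Z = V₊(𝔭)` (`SatLift.projIdealSheaf_eq_vanishingIdeal`,
  `𝔭` prime): the `IsRegular` input of `SatLift.liftableCentre_of_saturatedLift` / of res-type-032's `RatLift.isLiftableCentre_of_forms`, so that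
  specimens (032's rational quartic, part 4) fire the RatLift rung with NO extra certificate.

References: R. Hartshorne, *Algebraic Geometry* (1977), II Prop. 2.5, Prop. 5.9, Ex. 2.14/3.4 [Hartshorne1977]; Stacks 02IS [StacksProject];
cell: PLANNER-MEMO-g10-1 C3a, res-type-032 T-RATLIFT-ALG p530115/p531171 (index only, OURS).
-/

set_option linter.dupNamespace false -- mandated namespace `Summit.<Summit>.<Problem>` of this single-conjunct summit

noncomputable section

open CategoryTheory AlgebraicGeometry TopologicalSpace Opposite
open MvPolynomial HomogeneousLocalization
open Literature.AlgebraicGeometry.Resolution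
open Summit.ResolutionOfSingularities.ResolutionOfSingularities.Cruxes.EquisingularLift.StrataSplit

attribute [local instance] MvPolynomial.gradedAlgebra

namespace Summit.ResolutionOfSingularities.ResolutionOfSingularities.Cruxes.EquisingularLiftNat.Sections

namespace RatReg

/-! ## §1 The chart homomorphism `Θ_i : (k[x]_{x_i})₀ → (k[s]_{f_i})₀` -/

section Chart

variable {k : Type} [CommRing k] {n r : ℕ} (f : Fin (n + 1) → MvPolynomial (Fin (r + 1)) k) {e : ℕ}
  (hf : ∀ i, f i ∈ homogeneousSubmodule (Fin (r + 1)) k e)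

include hf in
/-- `aeval f g` is a form of degree `m • e` for `g` a form of degree `m • 1` (res-type-032's `RatLift.aeval_mem_homogeneousSubmodule`,
in the degree bookkeeping of `Away.mk`). [folklore] -/
theorem aeval_mem {m : ℕ} {g : MvPolynomial (Fin (n + 1)) k}
    (hg : g ∈ homogeneousSubmodule (Fin (n + 1)) k (m • 1)) :
    aeval f g ∈ homogeneousSubmodule (Fin (r + 1)) k (m • e) := by
  have hF : ∀ i, (f i).IsHomogeneous e := fun i => (mem_homogeneousSubmodule _ _).mp (hf i)
  have h := RatLift.aeval_mem_homogeneousSubmodule f hF (m := m) (by simpa using hg)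
  rwa [smul_eq_mul, mul_comm]

include hf in
/-- **The chart homomorphism.** For forms `f_j` of one degree `e` there is a ring homomorphism `Θ_i : (k[x]_{x_i})₀ → (k[s]_{f_i})₀` with
`Θ_i (g / x_i^m) = (aeval f g) / f_i^m` on forms `g` of degree `m` (the restriction to degree-zero parts of the localisation of `aeval f`;
constructed inside the proof — no definition is introduced). [cite: Hartshorne1977, II Prop. 2.5 (proof)] -/
theorem exists_awayHom (i : Fin (n + 1)) :
    ∃ Θ : Away (homogeneousSubmodule (Fin (n + 1)) k) (X i) →+* Away (homogeneousSubmodule (Fin (r + 1)) k) (f i),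
      ∀ (m : ℕ) (g : MvPolynomial (Fin (n + 1)) k) (hg : g ∈ homogeneousSubmodule (Fin (n + 1)) k (m • 1)),
        Θ (Away.mk _ (CILift.X_mem_one' i) m g hg) = Away.mk _ (hf i) m (aeval f g) (aeval_mem f hf hg) := by
  classical
  -- the localisation of `aeval f` : `k[x]_{x_i} → k[s]_{f_i}`
  have hsub : Submonoid.powers (X i : MvPolynomial (Fin (n + 1)) k) ≤
      (Submonoid.powers (f i)).comap (aeval (R := k) f).toRingHom := by
    rw [Submonoid.powers_le, Submonoid.mem_comap]
    change aeval f (X i) ∈ Submonoid.powers (f i)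
    rw [aeval_X]
    exact Submonoid.mem_powers _
  let Θt : Localization.Away (X i : MvPolynomial (Fin (n + 1)) k) →+* Localization.Away (f i) :=
    IsLocalization.map (Localization.Away (f i)) (aeval (R := k) f).toRingHom hsub
  have hΘt : ∀ (m : ℕ) (g : MvPolynomial (Fin (n + 1)) k),
      Θt (Localization.mk g ⟨X i ^ m, Submonoid.pow_mem _ (Submonoid.mem_powers _) m⟩) =
        Localization.mk (aeval f g) ⟨f i ^ m, Submonoid.pow_mem _ (Submonoid.mem_powers _) m⟩ := by
    intro m g
    rw [Localization.mk_eq_mk', IsLocalization.map_mk', Localization.mk_eq_mk']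
    congr 1
    exact Subtype.ext (by simp [map_pow])
  -- `val ∘ ?` lands in the image of `val`
  let vτ := (HomogeneousLocalization.val (𝒜 := homogeneousSubmodule (Fin (r + 1)) k) (x := Submonoid.powers (f i)))
  have hvτ : Function.Injective vτ := HomogeneousLocalization.val_injective _
  have hrange : ∀ q, Θt.comp (algebraMap (Away (homogeneousSubmodule (Fin (n + 1)) k) (X i)) (Localization.Away (X i : MvPolynomial (Fin (n + 1)) k))) q ∈ (algebraMap (Away (homogeneousSubmodule (Fin (r + 1)) k) (f i))
      (Localization.Away (f i))).range := by
    intro q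
    obtain ⟨m, g, hg, rfl⟩ := Away.mk_surjective _ (CILift.X_mem_one' i) q
    refine ⟨Away.mk _ (hf i) m (aeval f g) (aeval_mem f hf hg), ?_⟩
    change (Away.mk _ (hf i) m (aeval f g) (aeval_mem f hf hg)).val = Θt (Away.mk _ (CILift.X_mem_one' i) m g hg).val
    rw [Away.val_mk, Away.val_mk, hΘt]
  let e := RingEquiv.ofBijective (algebraMap (Away (homogeneousSubmodule (Fin (r + 1)) k) (f i)) (Localization.Away (f i))).rangeRestrict
    ⟨fun a b h => hvτ (Subtype.ext_iff.mp h), RingHom.rangeRestrict_surjective _⟩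
  refine ⟨e.symm.toRingHom.comp ((Θt.comp (algebraMap (Away (homogeneousSubmodule (Fin (n + 1)) k) (X i)) (Localization.Away (X i : MvPolynomial (Fin (n + 1)) k)))).codRestrict _ hrange), fun m g hg => ?_⟩
  apply hvτ
  change ((algebraMap (Away (homogeneousSubmodule (Fin (r + 1)) k) (f i)) (Localization.Away (f i))).rangeRestrict
    (e.symm ((Θt.comp (algebraMap (Away (homogeneousSubmodule (Fin (n + 1)) k) (X i)) (Localization.Away (X i : MvPolynomial (Fin (n + 1)) k)))).codRestrict _ hrange (Away.mk _ (CILift.X_mem_one' i) m g hg)))).1 = _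
  rw [show (algebraMap (Away (homogeneousSubmodule (Fin (r + 1)) k) (f i)) (Localization.Away (f i))).rangeRestrict =
      e.toRingHom from rfl]
  change (e (e.symm _)).1 = _
  rw [RingEquiv.apply_symm_apply]
  change Θt (Away.mk _ (CILift.X_mem_one' i) m g hg).val = (Away.mk _ (hf i) m (aeval f g) _).val
  rw [Away.val_mk, Away.val_mk, hΘt]

variable {f}

/-- **`ker Θ_i = 𝔭_{(x_i)}`** for `𝔭 = ker (aeval f)`: `(aeval f g)/f_i^m = 0` iff `f_i^N · aeval f g = 0` for some `N`, i.e. `x_i^N g ∈ 𝔭`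
(`SatLift.mk_mem_awayIdeal_iff`). [cite: Hartshorne1977, II Prop. 5.9 (proof)] -/
theorem ker_awayHom_eq (i : Fin (n + 1)) (he : 0 < e)
    (Θ : Away (homogeneousSubmodule (Fin (n + 1)) k) (X i) →+* Away (homogeneousSubmodule (Fin (r + 1)) k) (f i))
    (hΘ : ∀ (m : ℕ) (g : MvPolynomial (Fin (n + 1)) k) (hg : g ∈ homogeneousSubmodule (Fin (n + 1)) k (m • 1)),
      Θ (Away.mk _ (CILift.X_mem_one' i) m g hg) = Away.mk _ (hf i) m (aeval f g) (aeval_mem f hf hg)) :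
    RingHom.ker Θ = awayIdeal (homogeneousSubmodule (Fin (n + 1)) k) (CILift.X_mem_one' i)
      (HomogeneousIdeal.toIdeal (𝒜 := homogeneousSubmodule (Fin (n + 1)) k) ⟨RingHom.ker (aeval (R := k) f),
        RatLift.isHomogeneous_ker_aeval f (fun i => (mem_homogeneousSubmodule _ _).mp (hf i)) he⟩) := by
  ext q
  obtain ⟨m, g, hg, rfl⟩ := Away.mk_surjective _ (CILift.X_mem_one' i) q
  rw [RingHom.mem_ker, hΘ, Away.mk_eq_zero_iff, SatLift.mk_mem_awayIdeal_iff]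
  refine exists_congr fun N => ?_
  change _ ↔ X i ^ N * g ∈ RingHom.ker (aeval (R := k) f)
  rw [RingHom.mem_ker, map_mul, map_pow, aeval_X]

/-- **`Θ_i` is onto under the cofinite clause** `∀ m ≥ m₀, k[s]_{e m} ≤ aeval f (k[x]_m)`: `h / f_i^m = (f_i^{m₀} h) / f_i^{m₀+m}` and
`f_i^{m₀} h = aeval f g`. [cite: Hartshorne1977, II Ex. 3.4] -/
theorem awayHom_surjective (i : Fin (n + 1)) {m₀ : ℕ}
    (hcl : ∀ m, m₀ ≤ m → homogeneousSubmodule (Fin (r + 1)) k (e * m) ≤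
      (homogeneousSubmodule (Fin (n + 1)) k m).map (aeval (R := k) f).toLinearMap)
    (Θ : Away (homogeneousSubmodule (Fin (n + 1)) k) (X i) →+* Away (homogeneousSubmodule (Fin (r + 1)) k) (f i))
    (hΘ : ∀ (m : ℕ) (g : MvPolynomial (Fin (n + 1)) k) (hg : g ∈ homogeneousSubmodule (Fin (n + 1)) k (m • 1)),
      Θ (Away.mk _ (CILift.X_mem_one' i) m g hg) = Away.mk _ (hf i) m (aeval f g) (aeval_mem f hf hg)) :
    Function.Surjective Θ := by
  intro y
  obtain ⟨m, h, hh, rfl⟩ := Away.mk_surjective _ (hf i) y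
  -- `h / f_i^m = (f_i^{m₀} h) / f_i^{m₀ + m}`, and `f_i^{m₀} h ∈ k[s]_{e (m₀ + m)} = aeval f (k[x]_{m₀+m})`
  have hh' : f i ^ m₀ * h ∈ homogeneousSubmodule (Fin (r + 1)) k (e * (m₀ + m)) := by
    have := SetLike.mul_mem_graded (SetLike.pow_mem_graded m₀ (hf i)) hh
    rw [← add_smul] at this
    simpa [smul_eq_mul, mul_comm] using this
  obtain ⟨g, hg, hgh⟩ := hcl (m₀ + m) (Nat.le_add_right _ _) hh'
  have hg' : g ∈ homogeneousSubmodule (Fin (n + 1)) k ((m₀ + m) • 1) := by simpa using hg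
  have hgh' : aeval f g = f i ^ m₀ * h := hgh
  refine ⟨Away.mk _ (CILift.X_mem_one' i) (m₀ + m) g hg', ?_⟩
  rw [hΘ, Away.mk_eq_mk_pow_mul _ (hf i) m m₀ h hh]
  apply val_injective
  rw [Away.val_mk, Away.val_mk, hgh']

end Chart

/-! ## §2 `Spec (k[s]_{f_i})₀` is regular; the chart ring of `V(𝔭~)` -/

section Regular

variable {k : Type} [Field k] {n r : ℕ} (f : Fin (n + 1) → MvPolynomial (Fin (r + 1)) k) {e : ℕ}
  (hf : ∀ i, f i ∈ homogeneousSubmodule (Fin (r + 1)) k e) (he : 0 < e)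

include he in
/-- **`Spec (k[s]_{F})₀` is a regular scheme** for a form `F` of positive degree: it is the basic open `D₊(F)` of the regular `ℙ^r_k`
(`isRegular_projectiveSpace`) through the open immersion `Proj.awayι`. [cite: StacksProject, Tag 02IS] -/
theorem isRegular_Spec_away {F : MvPolynomial (Fin (r + 1)) k} (hF : F ∈ homogeneousSubmodule (Fin (r + 1)) k e) :
    Scheme.IsRegular (Spec (.of (Away (homogeneousSubmodule (Fin (r + 1)) k) F))) :=
  Scheme.IsRegular.of_isOpenImmersion (Proj.awayι (homogeneousSubmodule (Fin (r + 1)) k) F hF he)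
    (isRegular_projectiveSpace r k)

include hf he in
/-- **The chart ring of `V(𝔭~)` over `D₊(x_i)` is `(k[s]_{f_i})₀`**: `Γ(D₊(x_i)) / 𝔭~(D₊(x_i)) ≃ (k[x]_{x_i})₀ / 𝔭_{(x_i)} ≃ (k[s]_{f_i})₀`
(`awayToSection`, `SatLift.ideal_chart`, `Θ_i` with `ker_awayHom_eq` / `awayHom_surjective`) — stated as: `Spec` of the chart ring is a
regular scheme. [cite: Hartshorne1977, II Prop. 5.9] -/
theorem isRegular_Spec_chartQuotient (i : Fin (n + 1)) {m₀ : ℕ}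
    (hcl : ∀ m, m₀ ≤ m → homogeneousSubmodule (Fin (r + 1)) k (e * m) ≤
      (homogeneousSubmodule (Fin (n + 1)) k m).map (aeval (R := k) f).toLinearMap) :
    Scheme.IsRegular (Spec (.of (Γ(Proj (homogeneousSubmodule (Fin (n + 1)) k), Proj.basicOpen (homogeneousSubmodule (Fin (n + 1)) k) (X i)) ⧸
      (projIdealSheaf (homogeneousSubmodule (Fin (n + 1)) k)
        ⟨RingHom.ker (aeval (R := k) f), RatLift.isHomogeneous_ker_aeval f
          (fun i => (mem_homogeneousSubmodule _ _).mp (hf i)) he⟩).ideal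
        ⟨Proj.basicOpen (homogeneousSubmodule (Fin (n + 1)) k) (X i),
          Proj.isAffineOpen_basicOpen (homogeneousSubmodule (Fin (n + 1)) k) (X i) (CILift.X_mem_one' i) one_pos⟩))) := by
  set 𝔭 : HomogeneousIdeal (homogeneousSubmodule (Fin (n + 1)) k) := ⟨RingHom.ker (aeval (R := k) f),
    RatLift.isHomogeneous_ker_aeval f (fun i => (mem_homogeneousSubmodule _ _).mp (hf i)) he⟩ with h𝔭
  -- the chart homomorphism and its kernel / image
  obtain ⟨Θ, hΘ⟩ := exists_awayHom f hf i
  have hker := ker_awayHom_eq hf i he Θ hΘ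
  have hsurj := awayHom_surjective hf i hcl Θ hΘ
  -- `(k[x]_{x_i})₀ / 𝔭_{(x_i)} ≃ (k[s]_{f_i})₀`
  let e₁ : Away (homogeneousSubmodule (Fin (n + 1)) k) (X i) ⧸
      awayIdeal (homogeneousSubmodule (Fin (n + 1)) k) (CILift.X_mem_one' i) 𝔭.toIdeal ≃+*
        Away (homogeneousSubmodule (Fin (r + 1)) k) (f i) :=
    (Ideal.quotEquivOfEq hker.symm).trans (RingHom.quotientKerEquivOfSurjective hsurj)
  -- `Γ(D₊(x_i)) / 𝔭~(D₊(x_i)) ≃ (k[x]_{x_i})₀ / 𝔭_{(x_i)}` along the bijective `awayToSection`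
  have hbij := SatLift.awayToSection_bijective (k := k) (n := n) i
  let e₀ : Away (homogeneousSubmodule (Fin (n + 1)) k) (X i) ≃+*
      Γ(Proj (homogeneousSubmodule (Fin (n + 1)) k), Proj.basicOpen (homogeneousSubmodule (Fin (n + 1)) k) (X i)) :=
    RingEquiv.ofBijective (Proj.awayToSection (homogeneousSubmodule (Fin (n + 1)) k) (X i)).hom hbij
  have hideal : (projIdealSheaf (homogeneousSubmodule (Fin (n + 1)) k) 𝔭).ideal
      ⟨Proj.basicOpen (homogeneousSubmodule (Fin (n + 1)) k) (X i),
        Proj.isAffineOpen_basicOpen (homogeneousSubmodule (Fin (n + 1)) k) (X i) (CILift.X_mem_one' i) one_pos⟩ =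
      (awayIdeal (homogeneousSubmodule (Fin (n + 1)) k) (CILift.X_mem_one' i) 𝔭.toIdeal).map (e₀ : _ →+* _) :=
    SatLift.ideal_chart 𝔭 i
  let e₂ : Γ(Proj (homogeneousSubmodule (Fin (n + 1)) k), Proj.basicOpen (homogeneousSubmodule (Fin (n + 1)) k) (X i)) ⧸
      (projIdealSheaf (homogeneousSubmodule (Fin (n + 1)) k) 𝔭).ideal
        ⟨Proj.basicOpen (homogeneousSubmodule (Fin (n + 1)) k) (X i),
          Proj.isAffineOpen_basicOpen (homogeneousSubmodule (Fin (n + 1)) k) (X i) (CILift.X_mem_one' i) one_pos⟩ ≃+*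
      Away (homogeneousSubmodule (Fin (n + 1)) k) (X i) ⧸
        awayIdeal (homogeneousSubmodule (Fin (n + 1)) k) (CILift.X_mem_one' i) 𝔭.toIdeal :=
    (Ideal.quotientEquiv _ _ e₀ hideal).symm
  -- transport regularity along `Spec` of the composite isomorphism
  let eT := e₂.trans e₁
  haveI : IsIso (Spec.map (CommRingCat.ofHom eT.symm.toRingHom)) := by
    have : IsIso (CommRingCat.ofHom eT.symm.toRingHom) := (eT.symm.toCommRingCatIso).isIso_hom
    infer_instance
  exact Scheme.IsRegular.of_isOpenImmersion (Spec.map (CommRingCat.ofHom eT.symm.toRingHom)) (isRegular_Spec_away he (hf i))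

include hf he in
/-- **`V(𝔭~)` is a REGULAR scheme under the cofinite clause** (`𝔭 = ker (aeval f)`): it is covered by the open pieces
`Spec (Γ(D₊(x_i)) / 𝔭~(D₊(x_i))) → V(𝔭~)` (`ProjSubscheme.subschemePiece`, one for each standard chart), each regular by
`isRegular_Spec_chartQuotient`. [cite: StacksProject, Tag 02IS] -/
theorem isRegular_subscheme_projIdealSheaf_ker_aeval {m₀ : ℕ}
    (hcl : ∀ m, m₀ ≤ m → homogeneousSubmodule (Fin (r + 1)) k (e * m) ≤
      (homogeneousSubmodule (Fin (n + 1)) k m).map (aeval (R := k) f).toLinearMap) :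
    Scheme.IsRegular (projIdealSheaf (homogeneousSubmodule (Fin (n + 1)) k)
      ⟨RingHom.ker (aeval (R := k) f), RatLift.isHomogeneous_ker_aeval f
        (fun i => (mem_homogeneousSubmodule _ _).mp (hf i)) he⟩).subscheme := by
  set C := projIdealSheaf (homogeneousSubmodule (Fin (n + 1)) k)
    ⟨RingHom.ker (aeval (R := k) f), RatLift.isHomogeneous_ker_aeval f
      (fun i => (mem_homogeneousSubmodule _ _).mp (hf i)) he⟩ with hC
  refine Scheme.IsRegular.of_forall_exists_isOpenImmersion fun x => ?_
  obtain ⟨i, hxi⟩ := SatLift.exists_mem_chart (k := k) (C.subschemeι x)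
  let U : (Proj (homogeneousSubmodule (Fin (n + 1)) k)).affineOpens :=
    ⟨Proj.basicOpen (homogeneousSubmodule (Fin (n + 1)) k) (X i),
      Proj.isAffineOpen_basicOpen (homogeneousSubmodule (Fin (n + 1)) k) (X i) (CILift.X_mem_one' i) one_pos⟩
  refine ⟨_, Literature.AlgebraicGeometry.Motives.ProjSubscheme.subschemePiece C U, inferInstance, ?_, ?_⟩
  · rw [← Scheme.Hom.coe_opensRange, Literature.AlgebraicGeometry.Motives.ProjSubscheme.opensRange_subschemePiece]
    exact hxi
  · rw [hC]
    exact isRegular_Spec_chartQuotient f hf he i hcl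

include hf he in
/-- **T-RATREG — the cofinite clause makes `V(𝓘_Z)` regular.** `k` a field, forms `f : Fin (n+1) → k[s₀..s_r]` of one degree `e ≥ 1`
satisfying `∀ m ≥ m₀, k[s]_{e m} ≤ aeval f (k[x]_m)`, `𝔭 = ker (aeval f)`, `Z = {y | 𝔭 ≤ 𝔮_y}` (closed): the reduced closed subscheme `V(𝓘_Z)`
is REGULAR (`𝔭~ = 𝓘_Z` by `SatLift.projIdealSheaf_eq_vanishingIdeal`, `𝔭` prime). This is the `IsRegular` input of
`SatLift.liftableCentre_of_saturatedLift` (p530902) for the RatLift class — no Jacobian certificate is needed for rational (or Veronese-type)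
centres given by a closed-immersion parametrisation. [cite: Hartshorne1977, II Prop. 5.9 and Ex. 3.4; StacksProject, Tag 02IS] -/
theorem isRegular_subscheme_vanishingIdeal_of_clause {m₀ : ℕ}
    (hcl : ∀ m, m₀ ≤ m → homogeneousSubmodule (Fin (r + 1)) k (e * m) ≤
      (homogeneousSubmodule (Fin (n + 1)) k m).map (aeval (R := k) f).toLinearMap)
    (Z : Set (Proj (homogeneousSubmodule (Fin (n + 1)) k))) (hZ : IsClosed Z)
    (hZ𝔭 : Z = {y | RingHom.ker (aeval (R := k) f) ≤ y.asHomogeneousIdeal.toIdeal}) :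
    Scheme.IsRegular (Scheme.IdealSheafData.vanishingIdeal ⟨Z, hZ⟩).subscheme := by
  have hrad : (RingHom.ker (aeval (R := k) f)).IsRadical := (RatLift.isPrime_ker_aeval (R := k) f).isRadical
  rw [← SatLift.projIdealSheaf_eq_vanishingIdeal ⟨RingHom.ker (aeval (R := k) f), RatLift.isHomogeneous_ker_aeval f
      (fun i => (mem_homogeneousSubmodule _ _).mp (hf i)) he⟩ hrad Z hZ hZ𝔭]
  exact isRegular_subscheme_projIdealSheaf_ker_aeval f hf he hcl

include he in
/-- `isRegular_subscheme_vanishingIdeal_of_clause` with the degree hypothesis in the `IsHomogeneous` spelling of res-type-032's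
`RatLift.isLiftableCentre_of_forms` (so that the successor class-lift's `rat` case is a one-liner). [cite: StacksProject, Tag 02IS] -/
theorem isRegular_subscheme_vanishingIdeal_of_clause' (hf' : ∀ i, (f i).IsHomogeneous e) {m₀ : ℕ}
    (hcl : ∀ m, m₀ ≤ m → homogeneousSubmodule (Fin (r + 1)) k (e * m) ≤
      (homogeneousSubmodule (Fin (n + 1)) k m).map (aeval (R := k) f).toLinearMap)
    (Z : Set (Proj (homogeneousSubmodule (Fin (n + 1)) k))) (hZ : IsClosed Z)
    (hZ𝔭 : Z = {y | RingHom.ker (aeval (R := k) f) ≤ y.asHomogeneousIdeal.toIdeal}) :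
    Scheme.IsRegular (Scheme.IdealSheafData.vanishingIdeal ⟨Z, hZ⟩).subscheme :=
  isRegular_subscheme_vanishingIdeal_of_clause f (fun i => (mem_homogeneousSubmodule _ _).mpr (hf' i)) he hcl Z hZ hZ𝔭

end Regular

end RatReg

end Summit.ResolutionOfSingularities.ResolutionOfSingularities.Cruxes.EquisingularLiftNat.Sections

end
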